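import Summits.QuantumFields.YangMills.Theorems.BalabanUVNodesN05SubBP2DPerKappaSlotOfZd
import Literature.MathematicalPhysics.QuantumFieldTheory.Balaban1983to89.Node00.CarriersB8SubBPCutP5Kappa

/-!
# BalabanUVNodes ∕ N05 ([Balaban1985RegularSpaces] Lemma 1 p. 79 – Thm 8 p. 101, (1.3)–(1.5) p. 77, p. 77 «Ω_j ⊂ T_η»): EDITION «K2» OF P4 FILE 1 — THE κ-CUT ℤᵈ «P₂D» SLOT PASSES TO
# THE κ-CUT (β′-PERIODIC) δ₂-SLOT DIRECTLY (director-ym №227 (b′-2); plan YMPLAN-G87-N05-GO (R2))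

Track A of `YM-PLAN.md` (cell `pub-ymgap`, HUMAN RULING D-0062), node **N05**; seat `pub-ymgap-dag-n05-d` (g14, (R2) pen), 2026-08-28; bears on K1⁹ `stmt-QuantumFields-27364`
(`--supports … --as helper`, count-neutral).

WHAT (pure bookkeeping, conjunct by conjunct, BY NAME — p645824 `…N05SubBP2DPerKappaSlotOfZd` with the κ-cut made on the ℤᵈ side from birth): for a periodic residual layer
`lamPer : ResidB8Per θ P` whose ℤᵈ base carries dag-n05-w1's κ-CUT «P₂D» slot `B8LeafOfRecordSubBP₂Dκ θ M₁ R lamPer.base` (the `B8LeafRSC` leaf over `zdGF3HP₂` at the PRINT-CLASS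
members `IdxB8SubDκ θ M₁ R`, `Node00/CarriersB8SubDKappa` :227), dag-n05-w1's κ-cut periodic δ₂-slot `B8LeafOfRecordSubBP₂DPerκ θ P M₁ R lamPer` (K2 p643053 :76, `B8LeafRS` over
`famB8OfRecordSubBP₂DPer θ β len P ∘ Subtype.val` at `IdxB8SubDPerκ θ P M₁ R`) holds as soon as the two PERIODIC-ONLY conjuncts are supplied at the print-class periodic members —
Theorem 8's surviving form `t8Per` (this seat's «K2» periodic T8 knit on the periodic server p645630) and the display's Proposition-7 slot `p7Per` at `lamPer.toAxial ∘ val`: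
`l1 ∕ p5e ∕ p5u ∕ p6` verbatim; `t2 ∕ t4` by dag-n05-c's transfer′ along `ι := IdxB8SubDPerκ.toZdIdx`, `p := fun _ => P` (binders from p645824's `transferHyps_idxB8SubDPer` at
`j.1`), the ℤᵈ inputs restricted along `IdxB8SubDPerκ.toSubDκ`; `p3` by P1′'s pure-∀ transfer (`prop3Printed_famB8OfRecordSubBP₂DPer_of_subBP₂D` at `e := Subtype.val`).
WHAT IS PROVED (two theorems; no estimate; no new definition):
* ★★★ `b8LeafOfRecordSubBP₂DPerκ_of_subBP₂Dκ` — κ-cut ℤᵈ P₂D slot + `t8Per` + `p7Per` ⊢ the κ-cut periodic δ₂-slot over the base's own Prop-5 family (banked twin), at every `(P, M₁, R)`.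
* ★★★ `b8LeafOfRecordSubBP₂DPerκ_cutSubBP₅κPer_of_subBP₂Dκ` — at the pins of (R1′): the κ-cut ℤᵈ slot at `λ.cutSubBP₅κ M₁ R c₁ ρ₀` + `t8Per` + `p7Per` + the DISPLAYED periodic Prop-5
  existence `p5ePer` ⊢ the witness slot OF RECORD `B8LeafOfRecordSubBP₂DPerκ θ P M₁ R ⟨λ.cutSubBP₅κPer P M₁ R c₁ ρ₀, ax⟩` (plan LOCATED-4 ∕ (R3′)); `p5u` by dag-n05-c's pure-∀ transfer.
HONEST FRAMING: bookkeeping only; 0 estimates; `t8Per ∕ p7Per` displayed; count-neutral; **N05 NOT discharged** (director-ym №227 (b): this ℤᵈ-transfer road is the BANKED conditional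
twin; the discharge road is the guarded-socket package); K1⁹ NOT claimed; Bałaban AS PRINTED (Thm 8 SURVIVING form, GAPS G-B8-13); one finite 𝕋⁴ programme at fixed ε; nothing continuum ∕
ℝ⁴ ∕ OS ∕ mass-gap ∕ Clay.  No `sorry`, no new definition.  Unit `pub-ymgap-dag-n05-d` (g14).
[cite: Balaban1985RegularSpaces, Lemma 1 – Thm 8 pp.79–101, (1.3)–(1.5) p.77, p.77 («Ω_j ⊂ T_η»), (1.31) p.82; Balaban1985BackgroundPropagators, (3.40) p.397, Thm 3.3 p.399]
-/

noncomputable section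

namespace Summit.QuantumFields.YangMills.BalabanUVNodes.N05SubBP2DK2PerKappaSlotOfZd

open Literature.MathematicalPhysics.QuantumFieldTheory.Balaban1983to89
open Literature.MathematicalPhysics.QuantumFieldTheory.Balaban1983to89.Node00
open Literature.MathematicalPhysics.QuantumFieldTheory.Balaban1983to89.B8LeafModelZd (ZdIdx)
open Literature.MathematicalPhysics.QuantumFieldTheory.Balaban1983to89.B8LeafModelZd3P2 (zdGF3HP₂ zdGF3P₂)
open Literature.MathematicalPhysics.QuantumFieldTheory.Balaban1983to89.B8LeafModelZdHP2Per (zdGF3HP₂Per)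
open Literature.MathematicalPhysics.QuantumFieldTheory.Balaban1983to89.B8LeafModelZdHP2PerTransfer (thm2Printed_hp2per_of_zd thm4Printed_hp2per_of_zd)
open Summit.QuantumFields.YangMills.BalabanUVNodes.N05SubBP2DPerKappaSlotOfZd (transferHyps_idxB8SubDPer)
open Literature.MathematicalPhysics.QuantumFieldTheory.Balaban1983to89.B8Prop5LandauDataZdPer (prop5Unique_per_of_zd)

variable {θ : Stage3Params} {P M₁ R : ℕ}

/-- ★★★ **THE κ-CUT ℤᵈ «P₂D» SLOT PASSES TO THE κ-CUT (β′-PERIODIC) δ₂-SLOT**, given the two periodic-only conjuncts at the print-class periodic members: for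
`lamPer : ResidB8Per θ P` with `B8LeafOfRecordSubBP₂Dκ θ M₁ R lamPer.base`, Theorem 8's surviving form `t8Per` over `famB8OfRecordSubBP₂DPer θ β len P ∘ val` on `IdxB8SubDPerκ θ P M₁ R`
and the Proposition-7 slot `p7Per` at `lamPer.toAxial ∘ val`, dag-n05-w1's `B8LeafOfRecordSubBP₂DPerκ θ P M₁ R lamPer` holds — `l1 ∕ p5e ∕ p5u ∕ p6` verbatim (Prop 5 over the base's
own Prop-5 index, Prop 6 at its cubes), `t2 ∕ t4` by transfer′ along `IdxB8SubDPerκ.toZdIdx` with the ℤᵈ inputs restricted along `toSubDκ`, `p3` by P1′'s pure-∀ transfer.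
[cite: Balaban1985RegularSpaces, Lemma 1 p.79, Thm 2 p.83, Prop. 3 p.87, Thm 4 p.88, Prop. 5 p.94, Prop. 6 p.99, Prop. 7 p.100, Thm 8 p.101 (surviving form), (1.3)–(1.4) p.77, p.77 («Ω_j ⊂ T_η»)] -/
theorem b8LeafOfRecordSubBP₂DPerκ_of_subBP₂Dκ (lamPer : ResidB8Per θ P) (h : B8LeafOfRecordSubBP₂Dκ θ M₁ R lamPer.base)
    (t8Per : B8Thm8Surviving.Thm8SurvivingAt 1 lamPer.base.B₁ lamPer.base.B₂
      (fun j : IdxB8SubDPerκ θ P M₁ R => famB8OfRecordSubBP₂DPer θ lamPer.base.β lamPer.base.len P j.1))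
    (p7Per : B8SectGH.Prop7PrintedR (fun j : IdxB8SubDPerκ θ P M₁ R => famB8OfRecordSubBP₂DPer θ lamPer.base.β lamPer.base.len P j.1) fun j => lamPer.toAxial j.1) :
    B8LeafOfRecordSubBP₂DPerκ θ P M₁ R lamPer where
  l1 := h.l1
  t2 := thm2Printed_hp2per_of_zd (𝔸 := θ.𝔸) (β := lamPer.base.β) (len := lamPer.base.len) (le_trans one_le_two θ.two_le_L)
    (fun j : IdxB8SubDPerκ θ P M₁ R => j.1.toZdIdx) (fun _ => P) (fun j l => (transferHyps_idxB8SubDPer θ P).1 j.1 l) (fun j => (transferHyps_idxB8SubDPer θ P).2.1 j.1)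
    (fun j l hl => (transferHyps_idxB8SubDPer θ P).2.2.1 j.1 l hl) (fun j l hl κ => (transferHyps_idxB8SubDPer θ P).2.2.2 j.1 l hl κ)
    (B8LeafKnit.thm2Printed_precomp (fun j : IdxB8SubDPerκ θ P M₁ R => j.toSubDκ)
      (fun i : IdxB8SubDκ θ M₁ R => (famB8OfRecordSubBP₂D θ lamPer.base.β lamPer.base.len i.1).toGFData) h.t2)
  p3 := prop3Printed_famB8OfRecordSubBP₂DPer_of_subBP₂D (fun j : IdxB8SubDPerκ θ P M₁ R => j.1) lamPer.base.β lamPer.base.len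
    (B8LeafKnit.prop3Printed_precomp (fun j : IdxB8SubDPerκ θ P M₁ R => j.toSubDκ) θ.D (θ.L : ℝ) lamPer.base.C₂ lamPer.base.inp lamPer.base.B₀β
      (fun i : IdxB8SubDκ θ M₁ R => (famB8OfRecordSubBP₂D θ lamPer.base.β lamPer.base.len i.1).toGFData2) h.p3)
  t4 := thm4Printed_hp2per_of_zd (𝔸 := θ.𝔸) (β := lamPer.base.β) (len := lamPer.base.len) (le_trans one_le_two θ.two_le_L)
    (fun j : IdxB8SubDPerκ θ P M₁ R => j.1.toZdIdx) (fun _ => P) (fun j l => (transferHyps_idxB8SubDPer θ P).1 j.1 l) (fun j => (transferHyps_idxB8SubDPer θ P).2.1 j.1)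
    (fun j l hl => (transferHyps_idxB8SubDPer θ P).2.2.1 j.1 l hl) (fun j l hl κ => (transferHyps_idxB8SubDPer θ P).2.2.2 j.1 l hl κ)
    (B8LeafKnit.thm4Printed_precomp (fun j : IdxB8SubDPerκ θ P M₁ R => j.toSubDκ) lamPer.base.B₁'
      (fun i : IdxB8SubDκ θ M₁ R => (famB8OfRecordSubBP₂D θ lamPer.base.β lamPer.base.len i.1).toGFData) h.t4)
  p5e := h.p5e
  p5u := h.p5u
  p6 := h.p6
  p7 := p7Per
  t8 := t8Per


/-- ★★★ **THE κ-CUT ℤᵈ «P₂D» SLOT AT THE ℤᵈ κ-PIN PASSES TO THE WITNESS SLOT OF RECORD AT THE PERIODIC κ-PIN** (plan LOCATED-4 ∕ (R3′): term `λ.cutSubBP₅κPer P M₁ R c₁ ρ₀`):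
from dag-n05-w1's κ-cut ℤᵈ slot at `λ.cutSubBP₅κ M₁ R c₁ ρ₀` (Prop 5 over print-class members with ARBITRARY unitary backgrounds, on ℤᵈ), Theorem 8's surviving form `t8Per` and the
Proposition-7 slot `p7Per` at the print-class periodic δ₂-members, and PROPOSITION 5's EXISTENCE CLAUSE AT THE PERIODIC MEMBERS OF RECORD `p5ePer` (print's (1.108) on the torus —
the one conjunct that does NOT transfer from ℤᵈ: a ℤᵈ solution need not be periodic; displayed, to be served by the guarded periodic Proposition 5 of package «N05-(β′)-GT»), the
slot `B8LeafOfRecordSubBP₂DPerκ θ P M₁ R ⟨λ.cutSubBP₅κPer P M₁ R c₁ ρ₀, ax⟩` holds: `l1 ∕ p6` verbatim, `t2 ∕ t4` by transfer′, `p3` by P1′'s pure-∀ transfer, `p5u` by dag-n05-c's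
pure-∀ transfer `prop5Unique_per_of_zd` (uniqueness among periodic parameters is uniqueness among all) at the periodic index read in the ℤᵈ κ-index, `p5e := p5ePer`, `p7 := p7Per`,
`t8 := t8Per`. [cite: Balaban1985RegularSpaces, Lemma 1 p.79, Thm 2 p.83, Prop. 3 p.87, Thm 4 p.88, Prop. 5 (1.107)–(1.109) p.94, Prop. 6 p.99, Prop. 7 p.100, Thm 8 p.101 (surviving form), (1.3)–(1.4) p.77, p.77 («Ω_j ⊂ T_η»)] -/
theorem b8LeafOfRecordSubBP₂DPerκ_cutSubBP₅κPer_of_subBP₂Dκ (lam : ResidB8 θ) (c₁ : ℝ) (ρ₀ : ℕ)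
    (ax : ∀ j : IdxB8SubDPer θ P, (famB8OfRecordPer θ (lam.cutSubBP₅κPer P M₁ R c₁ ρ₀).β (lam.cutSubBP₅κPer P M₁ R c₁ ρ₀).len P j).Cfg →
      (famB8OfRecordPer θ (lam.cutSubBP₅κPer P M₁ R c₁ ρ₀).β (lam.cutSubBP₅κPer P M₁ R c₁ ρ₀).len P j).Pert →
      (famB8OfRecordPer θ (lam.cutSubBP₅κPer P M₁ R c₁ ρ₀).β (lam.cutSubBP₅κPer P M₁ R c₁ ρ₀).len P j).Pert)
    (h : B8LeafOfRecordSubBP₂Dκ θ M₁ R (lam.cutSubBP₅κ M₁ R c₁ ρ₀))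
    (t8Per : B8Thm8Surviving.Thm8SurvivingAt 1 lam.B₁ lam.B₂ (fun j : IdxB8SubDPerκ θ P M₁ R => famB8OfRecordSubBP₂DPer θ lam.β lam.len P j.1))
    (p7Per : B8SectGH.Prop7PrintedR (fun j : IdxB8SubDPerκ θ P M₁ R => famB8OfRecordSubBP₂DPer θ lam.β lam.len P j.1) fun j => ax j.1)
    (p5ePer : B8.Prop5Exists lam.inp.B₀' lam.B₁ (lanOfRecordSubCκPer θ P M₁ R lam.B₁)) :
    B8LeafOfRecordSubBP₂DPerκ θ P M₁ R ⟨lam.cutSubBP₅κPer P M₁ R c₁ ρ₀, ax⟩ := by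
  have hR := (b8LeafOfRecordSubBP₂Dκ_cutSubBP₅κ_iff lam c₁ ρ₀).1 h
  refine (b8LeafOfRecordSubBP₂DPerκ_cutSubBP₅κPer_iff lam c₁ ρ₀ ax).2 ?_
  exact
  { l1 := hR.l1
    t2 := thm2Printed_hp2per_of_zd (𝔸 := θ.𝔸) (β := lam.β) (len := lam.len) (le_trans one_le_two θ.two_le_L)
      (fun j : IdxB8SubDPerκ θ P M₁ R => j.1.toZdIdx) (fun _ => P) (fun j l => (transferHyps_idxB8SubDPer θ P).1 j.1 l) (fun j => (transferHyps_idxB8SubDPer θ P).2.1 j.1)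
      (fun j l hl => (transferHyps_idxB8SubDPer θ P).2.2.1 j.1 l hl) (fun j l hl κ => (transferHyps_idxB8SubDPer θ P).2.2.2 j.1 l hl κ)
      (B8LeafKnit.thm2Printed_precomp (fun j : IdxB8SubDPerκ θ P M₁ R => j.toSubDκ)
        (fun i : IdxB8SubDκ θ M₁ R => (famB8OfRecordSubBP₂D θ lam.β lam.len i.1).toGFData) hR.t2)
    p3 := prop3Printed_famB8OfRecordSubBP₂DPer_of_subBP₂D (fun j : IdxB8SubDPerκ θ P M₁ R => j.1) lam.β lam.len
      (B8LeafKnit.prop3Printed_precomp (fun j : IdxB8SubDPerκ θ P M₁ R => j.toSubDκ) θ.D (θ.L : ℝ) lam.C₂ lam.inp lam.B₀β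
        (fun i : IdxB8SubDκ θ M₁ R => (famB8OfRecordSubBP₂D θ lam.β lam.len i.1).toGFData2) hR.p3)
    t4 := thm4Printed_hp2per_of_zd (𝔸 := θ.𝔸) (β := lam.β) (len := lam.len) (le_trans one_le_two θ.two_le_L)
      (fun j : IdxB8SubDPerκ θ P M₁ R => j.1.toZdIdx) (fun _ => P) (fun j l => (transferHyps_idxB8SubDPer θ P).1 j.1 l) (fun j => (transferHyps_idxB8SubDPer θ P).2.1 j.1)
      (fun j l hl => (transferHyps_idxB8SubDPer θ P).2.2.1 j.1 l hl) (fun j l hl κ => (transferHyps_idxB8SubDPer θ P).2.2.2 j.1 l hl κ)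
      (B8LeafKnit.thm4Printed_precomp (fun j : IdxB8SubDPerκ θ P M₁ R => j.toSubDκ) lam.B₁'
        (fun i : IdxB8SubDκ θ M₁ R => (famB8OfRecordSubBP₂D θ lam.β lam.len i.1).toGFData) hR.t4)
    p5e := p5ePer
    p5u := by
      obtain ⟨c₂, c₃, hc₂, hc₃, H⟩ := hR.p5u
      exact prop5Unique_per_of_zd θ.L lam.B₁ (fun a : IdxB8LanCκPer θ P M₁ R => a.toZdLanIdx) (fun _ => P) ⟨c₂, c₃, hc₂, hc₃, fun a => H a.toLanCκ⟩
    p6 := hR.p6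
    p7 := p7Per
    t8 := t8Per }

end Summit.QuantumFields.YangMills.BalabanUVNodes.N05SubBP2DK2PerKappaSlotOfZd

end
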